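import Summits.Ventures.PercRepro.RankLevelSetUpFiveTargets

/-! # RankLevelSetUpFiveValid — A VALID VERTEX OF THE TRIANGLE ALWAYS EXISTS (night-1 g41; dossier §53.5 (a); on
`RankLevelSetUpFiveTargets`)

The type-B targets of a bad member `W` (§53.4) need a VALID coloop `c ∈ C`: `b ∉ cl (L ∪ (C ∖ c))`. In the
rank-`3` quotient `Q = N／L` the three coloops form a triangle, the sets `cl (L ∪ (C ∖ c))` are its three sides
(planes of `N` through the line `L`), two sides meet in the plane `cl (L ∪ c)` through their common vertex, and two
such planes meet in `L`. So a marked element `b` off the line `L` cannot lie on all three sides: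
**`exists_notMem_closure_of_triangle`** — for a line `L` (rank `2`) and three elements `c₁, c₂, c₃` with
`rk (L ∪ {c₁, c₂, c₃}) = 5` in a matroid of rank `5`, every `b ∉ cl L` misses one of `cl (L ∪ {c₂, c₃})`,
`cl (L ∪ {c₁, c₃})`, `cl (L ∪ {c₁, c₂})`. The tool is the submodular inequality on closures
(**`eRk_inter_closure_le`**: `rk (cl X ∩ cl Y) + rk (X ∪ Y) ≤ rk X + rk Y`). Every declaration has a docstring;
imports: the cell's own modules and Mathlib only. Axioms: standard. -/

namespace PercRepro

open Set Matroid

variable {α : Type}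

/-- **Submodularity on closures**: `rk (cl X ∩ cl Y) + rk (X ∪ Y) ≤ rk X + rk Y`. -/
lemma eRk_inter_closure_le (N : Matroid α) (X Y : Set α) :
    N.eRk (N.closure X ∩ N.closure Y) + N.eRk (X ∪ Y) ≤ N.eRk X + N.eRk Y := by
  have h := N.eRk_inter_add_eRk_union_le (N.closure X) (N.closure Y)
  rw [N.eRk_closure_eq, N.eRk_closure_eq, N.eRk_union_closure_left_eq, N.eRk_union_closure_right_eq] at h
  exact h

/-- **A point in two closures whose ranks are small is in a smaller closure**: if `b ∈ cl X ∩ cl Y`,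
`rk X ≤ r`, `rk Y ≤ r`, `rk (X ∪ Y) ≥ u`, and `rk Z = 2r − u` for a set `Z ⊆ cl X ∩ cl Y` with `Z ⊆ N.E`, then
`b ∈ cl Z`. -/
lemma mem_closure_of_mem_inter_closure {N : Matroid α} [N.Finite] {X Y Z : Set α} {b : α} (hb : b ∈ N.E)
    (hbX : b ∈ N.closure X) (hbY : b ∈ N.closure Y) (hZ : Z ⊆ N.closure X ∩ N.closure Y) {r u : ℕ}
    (hX : N.eRk X ≤ r) (hY : N.eRk Y ≤ r) (hXY : (u : ℕ∞) ≤ N.eRk (X ∪ Y)) (hur : u ≤ 2 * r)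
    (hZr : N.eRk Z = ((2 * r - u : ℕ) : ℕ∞)) : b ∈ N.closure Z := by
  by_contra hcon
  have h1 := eRk_inter_closure_le N X Y
  have hins : N.eRk (insert b Z) = N.eRk Z + 1 := Matroid.eRk_insert_eq_add_one ⟨hb, hcon⟩
  have hsub : insert b Z ⊆ N.closure X ∩ N.closure Y := Set.insert_subset ⟨hbX, hbY⟩ hZ
  have h2 : N.eRk (insert b Z) ≤ N.eRk (N.closure X ∩ N.closure Y) := N.eRk_mono hsub
  have h3 : N.eRk (N.closure X ∩ N.closure Y) + (u : ℕ∞) ≤ (r : ℕ∞) + r := by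
    calc N.eRk (N.closure X ∩ N.closure Y) + (u : ℕ∞)
        ≤ N.eRk (N.closure X ∩ N.closure Y) + N.eRk (X ∪ Y) := by gcongr
      _ ≤ N.eRk X + N.eRk Y := h1
      _ ≤ (r : ℕ∞) + r := by gcongr
  have h4 : N.eRk (N.closure X ∩ N.closure Y) ≤ ((2 * r - u : ℕ) : ℕ∞) := by
    have h5 : N.eRk (N.closure X ∩ N.closure Y) + (u : ℕ∞) ≤ ((2 * r - u : ℕ) : ℕ∞) + (u : ℕ∞) := by
      calc N.eRk (N.closure X ∩ N.closure Y) + (u : ℕ∞) ≤ (r : ℕ∞) + r := h3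
        _ = ((2 * r - u : ℕ) : ℕ∞) + (u : ℕ∞) := by
            norm_cast; omega
    exact (WithTop.add_le_add_iff_right (by simp : (u : ℕ∞) ≠ ⊤)).mp h5
  have h6 : N.eRk Z + 1 ≤ N.eRk Z := by
    calc N.eRk Z + 1 = N.eRk (insert b Z) := hins.symm
      _ ≤ N.eRk (N.closure X ∩ N.closure Y) := h2
      _ ≤ ((2 * r - u : ℕ) : ℕ∞) := h4
      _ = N.eRk Z := hZr.symm
  have h7 : N.eRk Z + 1 ≤ ((2 * r - u : ℕ) : ℕ∞) := h6.trans hZr.le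
  rw [hZr] at h7
  have h8 : ((2 * r - u + 1 : ℕ) : ℕ∞) ≤ ((2 * r - u : ℕ) : ℕ∞) := by
    rw [Nat.cast_add, Nat.cast_one]; exact h7
  have h9 : 2 * r - u + 1 ≤ 2 * r - u := ENat.coe_le_coe.mp h8
  omega

/-- **The rank of `L ∪ {c}` and `L ∪ {c, c'}` under the three coloops**: if `rk L = 2` and
`rk (insert c₁ (insert c₂ (insert c₃ L))) = 5`, then `rk (insert c₃ L) = 3` and `rk (insert c₂ (insert c₃ L)) = 4`
(and symmetrically). -/
lemma eRk_insert_of_triangle {N : Matroid α} {L : Set α} {c₁ c₂ c₃ : α} (hL : N.eRk L = 2)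
    (hC : N.eRk (insert c₁ (insert c₂ (insert c₃ L))) = 5) :
    N.eRk (insert c₃ L) = 3 ∧ N.eRk (insert c₂ (insert c₃ L)) = 4 := by
  have h3 : N.eRk (insert c₃ L) ≤ 3 := by
    calc N.eRk (insert c₃ L) ≤ N.eRk L + 1 := N.eRk_insert_le_add_one c₃ L
      _ = 3 := by rw [hL]; norm_num
  have h4 : N.eRk (insert c₂ (insert c₃ L)) ≤ N.eRk (insert c₃ L) + 1 := N.eRk_insert_le_add_one _ _
  have h5 : N.eRk (insert c₁ (insert c₂ (insert c₃ L))) ≤ N.eRk (insert c₂ (insert c₃ L)) + 1 :=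
    N.eRk_insert_le_add_one _ _
  rw [hC] at h5
  -- `5 ≤ rk(L ∪ {c₂,c₃}) + 1 ≤ rk(L ∪ {c₃}) + 2 ≤ 5`
  have h45 : (4 : ℕ∞) ≤ N.eRk (insert c₂ (insert c₃ L)) := by
    have : (4 : ℕ∞) + 1 ≤ N.eRk (insert c₂ (insert c₃ L)) + 1 := by
      calc (4 : ℕ∞) + 1 = 5 := by norm_num
        _ ≤ N.eRk (insert c₂ (insert c₃ L)) + 1 := h5
    exact (WithTop.add_le_add_iff_right (by simp : (1 : ℕ∞) ≠ ⊤)).mp this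
  have h34 : (3 : ℕ∞) ≤ N.eRk (insert c₃ L) := by
    have : (3 : ℕ∞) + 1 ≤ N.eRk (insert c₃ L) + 1 := by
      calc (3 : ℕ∞) + 1 = 4 := by norm_num
        _ ≤ N.eRk (insert c₂ (insert c₃ L)) := h45
        _ ≤ N.eRk (insert c₃ L) + 1 := h4
    exact (WithTop.add_le_add_iff_right (by simp : (1 : ℕ∞) ≠ ⊤)).mp this
  have hr3 : N.eRk (insert c₃ L) = 3 := le_antisymm h3 h34
  refine ⟨hr3, le_antisymm ?_ h45⟩
  rw [hr3] at h4
  calc N.eRk (insert c₂ (insert c₃ L)) ≤ 3 + 1 := h4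
    _ = 4 := by norm_num

/-- **A marked element off the line misses one side of the triangle** (night-1 g41, §53.5 (a)): `N` of rank `5`,
`L` of rank `2`, `c₁, c₂, c₃` with `rk (L ∪ {c₁, c₂, c₃}) = 5`, `b ∈ E` with `b ∉ cl L`. Then `b` is off
`cl (L ∪ {c₂, c₃})`, `cl (L ∪ {c₁, c₃})` or `cl (L ∪ {c₁, c₂})`. -/
theorem exists_notMem_closure_of_triangle {N : Matroid α} [N.Finite] {L : Set α} (hLE : L ⊆ N.E)
    (hL : N.eRk L = 2) {c₁ c₂ c₃ : α} (hc₁ : c₁ ∈ N.E) (hc₂ : c₂ ∈ N.E) (hc₃ : c₃ ∈ N.E)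
    (hC : N.eRk (insert c₁ (insert c₂ (insert c₃ L))) = 5) {b : α} (hb : b ∈ N.E) (hbL : b ∉ N.closure L) :
    b ∉ N.closure (insert c₂ (insert c₃ L)) ∨ b ∉ N.closure (insert c₁ (insert c₃ L)) ∨
      b ∉ N.closure (insert c₁ (insert c₂ L)) := by
  by_contra hcon
  simp only [not_or, not_not] at hcon
  obtain ⟨h₁, h₂, h₃⟩ := hcon
  -- the ranks of the sides and of the vertices' planes
  have hC' : N.eRk (insert c₂ (insert c₁ (insert c₃ L))) = 5 := by
    rw [show insert c₂ (insert c₁ (insert c₃ L)) = insert c₁ (insert c₂ (insert c₃ L)) from by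
      ext x; simp only [Set.mem_insert_iff]; tauto]
    exact hC
  have hC'' : N.eRk (insert c₃ (insert c₁ (insert c₂ L))) = 5 := by
    rw [show insert c₃ (insert c₁ (insert c₂ L)) = insert c₁ (insert c₂ (insert c₃ L)) from by
      ext x; simp only [Set.mem_insert_iff]; tauto]
    exact hC
  have hC₁ : N.eRk (insert c₂ (insert c₃ (insert c₁ L))) = 5 := by
    rw [show insert c₂ (insert c₃ (insert c₁ L)) = insert c₁ (insert c₂ (insert c₃ L)) from by
      ext x; simp only [Set.mem_insert_iff]; tauto]
    exact hC
  obtain ⟨hr3, hr23⟩ := eRk_insert_of_triangle hL hC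
  obtain ⟨-, hr13⟩ := eRk_insert_of_triangle hL hC'
  obtain ⟨-, hr12⟩ := eRk_insert_of_triangle hL hC''
  obtain ⟨hr1, -⟩ := eRk_insert_of_triangle hL hC₁
  -- `b ∈ cl (L ∪ {c₃})`: the sides through `c₃` meet in its plane
  have hb3 : b ∈ N.closure (insert c₃ L) := by
    refine mem_closure_of_mem_inter_closure hb h₁ h₂ ?_ (r := 4) (u := 5) hr23.le hr13.le ?_ (by norm_num) ?_
    · intro x hx
      exact ⟨N.subset_closure _ (Set.insert_subset hc₂ (Set.insert_subset hc₃ hLE))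
          (Set.mem_insert_of_mem _ hx),
        N.subset_closure _ (Set.insert_subset hc₁ (Set.insert_subset hc₃ hLE))
          (by rcases hx with rfl | hx
              · exact Set.mem_insert_of_mem _ (Set.mem_insert _ _)
              · exact Set.mem_insert_of_mem _ (Set.mem_insert_of_mem _ hx))⟩
    · have e : insert c₂ (insert c₃ L) ∪ insert c₁ (insert c₃ L) = insert c₁ (insert c₂ (insert c₃ L)) := by
        ext x; simp only [Set.mem_union, Set.mem_insert_iff]; tauto
      rw [e, hC]; norm_num
    · rw [hr3]; norm_num
  -- `b ∈ cl (L ∪ {c₁})`: the sides through `c₁` meet in its plane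
  have hb1 : b ∈ N.closure (insert c₁ L) := by
    refine mem_closure_of_mem_inter_closure hb h₂ h₃ ?_ (r := 4) (u := 5) hr13.le hr12.le ?_ (by norm_num) ?_
    · intro x hx
      exact ⟨N.subset_closure _ (Set.insert_subset hc₁ (Set.insert_subset hc₃ hLE))
          (by rcases hx with rfl | hx
              · exact Set.mem_insert _ _
              · exact Set.mem_insert_of_mem _ (Set.mem_insert_of_mem _ hx)),
        N.subset_closure _ (Set.insert_subset hc₁ (Set.insert_subset hc₂ hLE))
          (by rcases hx with rfl | hx
              · exact Set.mem_insert _ _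
              · exact Set.mem_insert_of_mem _ (Set.mem_insert_of_mem _ hx))⟩
    · have e : insert c₁ (insert c₃ L) ∪ insert c₁ (insert c₂ L) = insert c₁ (insert c₂ (insert c₃ L)) := by
        ext x; simp only [Set.mem_union, Set.mem_insert_iff]; tauto
      rw [e, hC]; norm_num
    · rw [hr1]; norm_num
  -- the two planes meet in the line: `b ∈ cl L`
  have hbL' : b ∈ N.closure L := by
    refine mem_closure_of_mem_inter_closure hb hb1 hb3 ?_ (r := 3) (u := 4) hr1.le hr3.le ?_ (by norm_num) ?_
    · intro x hx
      exact ⟨N.subset_closure _ (Set.insert_subset hc₁ hLE) (Set.mem_insert_of_mem _ hx),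
        N.subset_closure _ (Set.insert_subset hc₃ hLE) (Set.mem_insert_of_mem _ hx)⟩
    · have e : insert c₁ L ∪ insert c₃ L = insert c₁ (insert c₃ L) := by
        ext x; simp only [Set.mem_union, Set.mem_insert_iff]; tauto
      rw [e, hr13]; norm_num
    · rw [hL]; norm_num
  exact hbL hbL'

end PercRepro
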